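import Literature.AlgebraicGeometry.HodgeTheory.FermatHodgeConjectureAssembly
import HarnessLib

/-!
# Aoki's "claim(α)" calculus on Fermat varieties: juxtaposition, pair cancellation, linear spaces and `p`-standard cycles

Family `hodge`, layer `Literature/AlgebraicGeometry/HodgeTheory`. NAMED FACTS (D-0014, `def … : Prop`,
nothing is proved here) recording, on the REAL carriers of this layer (`fermatEigenspace m α k ⊆
Hᵏ(Xⁿₘ(ℂ); ℂ)`, `algebraicClasses (fermatHypersurface n m) p`, `FermatCharacter.IsHodge / IsPaired`),
the four printed engines by which eigenlines `V(α)` of the Fermat variety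
`Xⁿₘ : x₀ᵐ + ⋯ + x_{n+1}ᵐ = 0 ⊂ ℙⁿ⁺¹_ℂ` are shown to consist of classes of algebraic cycles —
Aoki, J. Math. Soc. Japan 39 (1987) 385–396 (text read, pp. 385–388):

> "The Hodge conjecture for `Xⁿₘ` asserts that the following claim is true for every `α ∈ 𝔅ⁿₘ`.
> CLAIM(α): `V(α)` is generated by the cohomology classes of algebraic cycles on `Xⁿₘ`." (p. 385)
> "THEOREM 1-1 (Shioda [6]). The linear space `L` represents `δ`." (`δ = (a₀, -a₀, …, a_r, -a_r) ∈ 𝔇ⁿₘ`,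
> `L : x_{2i} + ε x_{2i+1} = 0`, `ε = exp(π√-1/m)`; "Ran and Shioda showed that any element of `𝔇ⁿₘ`
> is represented by a certain algebraic cycle", p. 386; "If `ω_α(Z) ≠ 0`, we say that `Z` represents
> the class `α`"; "If there exists an algebraic cycle `Z` on `Xⁿₘ` such that `ω_α(Z) ≠ 0`, then
> claim(α) is true", p. 386.)
> "THEOREM 1-4 (Shioda [4], Ran [3]). Let `r` and `s` be non-negative even integers such that
> `n = r + s + 2`, and let `α ∈ 𝔅ʳₘ`, `β ∈ 𝔅ˢₘ`. Then the following statements hold.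
> (i) If claim(α) and claim(β) are true, then claim(α∗β) is also true.
> (ii) If there exists `δ ∈ 𝔇ₘ` such that claim(α∗δ) is true, then claim(α) is also true." (p. 388;
> `∗` the juxtaposition, `𝔇ₘ = ⋃ₙ 𝔇ⁿₘ` the characters `∼ (a₀, -a₀, …, a_r, -a_r)`, pp. 386–387.)
> "THEOREM 2-1. The variety `Y` defined by (2.1) is a subvariety of `X^{p-1}ₘ` of codimension `r` and
> it represents the class `α`. More precisely we have `ω_α(Y)·\overline{ω_α(Y)} = (-1)ʳ p^{p-2} mᵖ`."
> (p. 388; `m = pd`, `p ≥ 3` prime, `r = (p-1)/2`, `α = σ_{p,a} = (a, a+d, …, a+(p-1)d, -pa)`,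
> `(a, d) = 1`; the `p`-standard elements `σ_{p,i}` are defined for `d/(i,d) > 2`, p. 387.)

These are exactly the "known supply" used by Shioda's inductive proof of the Hodge conjecture for
`Xⁿₘ` (`m` prime or `m ≤ 20`: the tree's named fact `hodgeClasses_algebraic_fermat` and its proof
files `FermatHodgeConjectureAssembly`, `FermatShiodaCondition`, whose hypothesis `hB` /
structure `IsShiodaClosed` ask for precisely such closure properties) and by Aoki's Cor. 2-3 (`m` a
prime power). They ground the support item `ShiodaAokiSupply` (stmt-HodgeConjecture-11122) of route
`Summit.HodgeConjecture.HodgeConjecture.Theses.DerivedTorelliFermat`: a Hodge character of `X⁴ₘ`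
which after juxtaposing pairs is a juxtaposition of pairs, Fermat-surface characters,
semi-decomposable sextuples and `5`-standard elements has algebraic `V(α)` — from
`Aoki1987_claim_juxtaposition` (iterate), `Aoki1987_claim_of_claim_juxtaposition_paired` (cancel
the pairs), `Shioda_claim_paired`, `Aoki1987_claim_pStandard` (`p = 5`), Lefschetz `(1,1)` on
`X²ₘ` and Shioda's type-II (semi-decomposable) case — the last two are NOT restated here.

## Rendering and faithfulness

* `claim(α)` for `α ∈ 𝔅^{2r}ₘ` (a character with `2r + 2` coordinates) is
  `FermatCharacter.Claim m r α : fermatEigenspace m α (2r) ≤ algebraicClasses (fermatHypersurface (2r) m) r`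
  — `V(α)`, a line in `H²ʳ(X²ʳₘ(ℂ); ℂ)` (inside the primitive part automatically, `α ≠ 0`), lies in
  the `ℂ`-span of the classes of codimension-`r` algebraic cycles ("generated by the cohomology
  classes of algebraic cycles"). For `r = 2` this is LITERALLY the conclusion
  `fermatEigenspace m α (2 * 2) ≤ algebraicClasses (fermatHypersurface (2 * 2) m) 2` of the route
  items (`abbrev`, unfolds by `rfl`).
* Juxtaposition UP TO PERMUTATION of the coordinates is rendered by equality of multisets of values,
  `univ.val.map γ = univ.val.map α + univ.val.map β` (the form in which Thm. 1-4 is applied in the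
  proof of Cor. 2-3 through the `∼`-statements Thm. 1-2/1-3, and in which da Silva, arXiv:2101.04739,
  states the sufficient conditions (P1)/(P2) after Cor. 2.3: "`α ∼ β′∗γ′` … where `∼` means equality
  up to permutation between factors"; permuting coordinates is an automorphism of `Xⁿₘ` carrying
  `V(α)` to `V(α ∘ π)` and algebraic classes to algebraic classes). This is the only strengthening of
  the letter of Thm. 1-4, and it is how every source uses it.
* `α ∈ 𝔅^{2r}ₘ` is `FermatCharacter.IsHodge α` for `α : Fin (2r+2) → ℤ/m` (all `αᵢ ≠ 0`, `Σ αᵢ = 0`,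
  `2|tα| = 2r + 2` for all units `t`); `δ ∈ 𝔇ₘ` is `(∀ i, δ i ≠ 0) ∧ FermatCharacter.IsPaired δ`
  (a fixed-point-free involution `σ` of the indices with `δ (σ i) = -δ i`, i.e. `δ ∼ (a₀,-a₀,…)`).
* Thm. 2-1 is vendored through its printed consequence "represents ⟹ claim" (p. 386): for an odd
  prime `p ∣ m`, `d = m/p > 2`, `(a, d) = 1`, `claim(σ_{p,a})` holds on `X^{p-1}ₘ`; the side condition
  `d/(a,d) > 2` of the definition of `σ_{p,i}` (p. 387) is kept as `2 < m / p`.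
* Dimension `0` (`r = 0`: `X⁰ₘ`, `m` points of `ℙ¹`; `𝔅⁰ₘ = 𝔇⁰ₘ`, the pairs `(a, -a)`) is allowed, as
  printed ("non-negative even integers").
* Upper bound: each fact is an instance of the Hodge conjecture for Fermat varieties (the
  `V(α)`, `α ∈ 𝔅`, are spanned by rational `(r,r)`-classes of `⊕ₜ V(tα)`), so nothing stronger than
  `HodgeConjectureFor` on Fermat varieties is asserted; Thm. 1-4, 1-1, 2-1 are unconditional in print.

## What is NOT here

Shioda's inductive structure itself (the blow-up correspondence `Xʳₘ × Xˢₘ ⇢ X^{r+s}ₘ`, Math. Ann.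
245 (1979) Thm. I–II; da Silva Thm. 2.2) of which Thm. 1-4 is the consequence for eigenlines; the
type-II / semi-decomposable case (`X¹ₘ × X¹ₘ`, curve characters) and Lefschetz `(1,1)` on `X²ₘ`
(tree: `lefschetzOneOne_rational`); Aoki's structure theorems 1-2/1-3 (= Thm. D of Aoki, Math. Ann.
266 (1983), with the semi-standard elements: not held, acq-03503) and Cor. 2-3; Remark 2-2 (`p = 2`).

## References

* [Aoki1987] N. Aoki, Some new algebraic cycles on Fermat varieties, J. Math. Soc. Japan 39 (1987)
  385–396: p. 385 (claim(α)), Thm. 1-1 and p. 386 (represents ⟹ claim), §1 p. 387 (`σ_{p,i}`, `𝔇ₘ`),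
  Thm. 1-4 (p. 388), Thm. 2-1 (p. 388), Cor. 2-3 (text read).
* [Shioda1979HodgeFermat] T. Shioda, The Hodge conjecture for Fermat varieties, Math. Ann. 245 (1979)
  175–184 (Aoki's [4]; cite-only).
* [Ran1980] Z. Ran, Cycles on Fermat hypersurfaces, Compositio Math. 42 (1980) 121–142 (Aoki's [3];
  linear subspaces and ruled joins).
* [daSilva2021HodgeFermat] G. da Silva Jr., Notes on the Hodge Conjecture for Fermat Varieties,
  arXiv:2101.04739, Thm. 2.2, Cor. 2.3 and conditions (P1), (P2) (text read).
-/

noncomputable section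

open Finset

namespace Literature.AlgebraicGeometry.HodgeTheory

namespace FermatCharacter

/-- **Aoki's `claim(α)`** for a character `α` of `X²ʳₘ` (`2r + 2` coordinates): "`V(α)` is
generated by the cohomology classes of algebraic cycles on `Xⁿₘ`" (`n = 2r`), i.e. the eigenline
`V(α) ⊆ H²ʳ(X²ʳₘ(ℂ); ℂ)` lies in the `ℂ`-span `algebraicClasses _ r` of the classes of
codimension-`r` cycles on the standard model `fermatHypersurface (2r) m = V₊(Σ xᵢᵐ) ⊂ ℙ²ʳ⁺¹`.
For `r = 2` this unfolds (`rfl`) to the conclusion of the route items of `DerivedTorelliFermat`.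
[cite: Aoki1987, Introduction p. 385 (CLAIM(α))] -/
abbrev Claim (m r : ℕ) (α : Fin (2 * r + 2) → ZMod m) : Prop :=
  fermatEigenspace m α (2 * r) ≤ algebraicClasses (fermatHypersurface (2 * r) m) r

end FermatCharacter

/-- **Aoki 1987, Thm. 1-4 (i) (Shioda 1979 / Ran 1980): juxtaposition of cycle characters is a cycle
character.** "Let `r` and `s` be non-negative even integers such that `n = r + s + 2`, and let
`α ∈ 𝔅ʳₘ`, `β ∈ 𝔅ˢₘ`. (i) If claim(α) and claim(β) are true, then claim(α∗β) is also true."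
Rendering (module docstring): dimensions `2r`, `2s`, `2(r+s+1)`; `α∗β` up to permutation of the
coordinates = any `γ` whose multiset of values is that of `α` plus that of `β`.
Grounds `Summit.HodgeConjecture.HodgeConjecture.Theses.DerivedTorelliFermat.ShiodaAokiSupply`.
[cite: Aoki1987, Thm. 1-4 (i), p. 388] [cite: daSilva2021HodgeFermat, Cor. 2.3 and condition (P1)] -/
def Aoki1987_claim_juxtaposition : Prop :=
  ∀ (m r s : ℕ) [NeZero m] (α : Fin (2 * r + 2) → ZMod m) (β : Fin (2 * s + 2) → ZMod m)
    (γ : Fin (2 * (r + s + 1) + 2) → ZMod m),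
    FermatCharacter.IsHodge α → FermatCharacter.IsHodge β →
    univ.val.map γ = univ.val.map α + univ.val.map β →
    FermatCharacter.Claim m r α → FermatCharacter.Claim m s β →
      FermatCharacter.Claim m (r + s + 1) γ

/-- **Aoki 1987, Thm. 1-4 (ii) (Shioda 1979 / Ran 1980): pair cancellation.** "(ii) If there exists
`δ ∈ 𝔇ₘ` such that claim(α∗δ) is true, then claim(α) is also true." (`α ∈ 𝔅^{2r}ₘ`; `δ ∈ 𝔇ₘ`: all
coordinates non-zero and `δ ∼ (a₀, -a₀, …, a_t, -a_t)`, here `IsPaired δ`; `α∗δ` up to permutation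
= any `γ` on `X^{2(r+t+1)}ₘ` with multiset of values that of `α` plus that of `δ`.)
Grounds `Summit.HodgeConjecture.HodgeConjecture.Theses.DerivedTorelliFermat.ShiodaAokiSupply`
(the "added pairs `Q + (-Q)`" of Shioda–Aoki reachability).
[cite: Aoki1987, Thm. 1-4 (ii), p. 388] -/
def Aoki1987_claim_of_claim_juxtaposition_paired : Prop :=
  ∀ (m r t : ℕ) [NeZero m] (α : Fin (2 * r + 2) → ZMod m) (δ : Fin (2 * t + 2) → ZMod m)
    (γ : Fin (2 * (r + t + 1) + 2) → ZMod m),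
    FermatCharacter.IsHodge α → (∀ i, δ i ≠ 0) → FermatCharacter.IsPaired δ →
    univ.val.map γ = univ.val.map α + univ.val.map δ →
    FermatCharacter.Claim m (r + t + 1) γ → FermatCharacter.Claim m r α

/-- **Aoki 1987, Thm. 1-1 (Shioda; Ran 1980): linear subspaces represent the paired characters.**
"THEOREM 1-1 (Shioda [6]). The linear space `L` represents `δ`" for
`δ = (a₀, -a₀, …, a_r, -a_r) ∈ 𝔇ⁿₘ` and `L : x_{2i} + ε x_{2i+1} = 0` (`0 ≤ i ≤ r`), `ε = exp(π√-1/m)`;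
"Ran and Shioda showed that any element of `𝔇ⁿₘ` is represented by a certain algebraic cycle";
and "if there exists an algebraic cycle `Z` on `Xⁿₘ` such that `ω_α(Z) ≠ 0`, then claim(α) is true"
(p. 386). Rendering: for every character `δ` of `X²ʳₘ` with all `δᵢ ≠ 0` which is paired
(`IsPaired`: `δ (σ i) = -δ i` for a fixed-point-free involution `σ`, i.e. `δ ∈ 𝔇²ʳₘ` up to
permutation — permute the coordinates of `L` accordingly), claim(δ) holds.
[cite: Aoki1987, Thm. 1-1 and p. 386] [cite: Ran1980, Thm. 4.9] -/
def Shioda_claim_paired : Prop :=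
  ∀ (m r : ℕ) [NeZero m] (δ : Fin (2 * r + 2) → ZMod m),
    (∀ i, δ i ≠ 0) → FermatCharacter.IsPaired δ → FermatCharacter.Claim m r δ

/-- **Aoki 1987, Thm. 2-1: the `p`-standard elements are represented by an explicit subvariety,
hence claim(σ_{p,a}) holds.** "Let `p (≥ 3)` and `d` be as before (i.e. `m = pd`), and put
`r = (p-1)/2`. Let `α = σ_{p,a} = (a, a+d, …, a+(p-1)d, -pa)`, `(a, d) = 1` … THEOREM 2-1. The
variety `Y` defined by (2.1) [`x₀^{kd} + x₁^{kd} + ⋯ + x_{p-1}^{kd} = 0 (1 ≤ k ≤ r)`,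
`x_pᵖ - εᵖ ᵈ√p · x₀x₁⋯x_{p-1} = 0`] is a subvariety of `X^{p-1}ₘ` of codimension `r` and it represents
the class `α`. More precisely we have `ω_α(Y)·\overline{ω_α(Y)} = (-1)ʳ p^{p-2} mᵖ`." With
"represents ⟹ claim" (p. 386). Rendering: `p = 2r + 1` prime, `p ∣ m`, `d = m / p` with `d > 2`
(the standing condition `d/(a,d) > 2` under which `σ_{p,a}` is defined, p. 387), `a : ℤ/m` with
`(⟨a⟩, d) = 1`, and `σ : Fin (2r+2) → ℤ/m` any character whose multiset of values is
`{a + k d : 0 ≤ k < p} + {-(p a)}` (i.e. `σ ∼ σ_{p,a}`); then claim(σ) holds on `X^{2r}ₘ = X^{p-1}ₘ`.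
For `p = 5` (`r = 2`) these are the `5`-standard sextuples of the Fermat FOURFOLD used by route
`DerivedTorelliFermat` (items `K3Exhaustion`, `ShiodaAokiSupply`).
[cite: Aoki1987, Thm. 2-1 (p. 388) with §1 p. 387 (σ_{p,i}) and p. 386 (represents ⟹ claim)] -/
def Aoki1987_claim_pStandard : Prop :=
  ∀ (m p r : ℕ) [NeZero m], p.Prime → p = 2 * r + 1 → p ∣ m → 2 < m / p →
    ∀ a : ZMod m, Nat.Coprime a.val (m / p) →
    ∀ σ : Fin (2 * r + 2) → ZMod m,
      univ.val.map σ =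
        (Multiset.range p).map (fun k : ℕ => a + (k : ZMod m) * ((m / p : ℕ) : ZMod m)) +
          {-((p : ZMod m) * a)} →
      FermatCharacter.Claim m r σ

/-! ### Sanity: the route's spelling is the `r = 2` instance -/

/-- `Claim m 2 α` is literally the conclusion of the `DerivedTorelliFermat` items. [folklore] -/
example (m : ℕ) (α : Fin (2 * 2 + 2) → ZMod m) :
    FermatCharacter.Claim m 2 α ↔
      fermatEigenspace m α (2 * 2) ≤ algebraicClasses (fermatHypersurface (2 * 2) m) 2 :=
  Iff.rfl

end Literature.AlgebraicGeometry.HodgeTheory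

end
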